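import Mathlib
import Summits.HodgeConjecture.FermatCycles.HodgeFermatBadVanishA
import Summits.HodgeConjecture.FermatCycles.HodgeFermatBadVanishC

/-!
# The Bad coefficients vanish — part 4: the supports, the vanishing under `IneqV N`, THEOREM F*(3N) `thmFstar_of_ineq` (`HodgeFermat/BadVanish.lean`; HF-G33)

Tree copy (part 4 of 4) of the module `HodgeFermat/BadVanish.lean` of the sibling cell's standalone package
`run/shared/lean/pub/pub-hodgefermat/lean/HodgeFermat/` (996 lines, sha256 `0bc1ccd5eb68b6bb…`), source lines 702–996 (§6 (cont.) the supports of `E⁻` and `D⁺`; §7 the Bad coefficients vanish under `IneqV N`: `mu_even_of_ineq`, `nu_odd_of_ineq`, `badVanishMu_of_ineq`, `badVanishNu_of_ineq`, THEOREM F*(3N) `thmFstar_of_ineq`).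
Filed by cell `pub-hfermat`, seat prover-1 gen-2, on the COORDINATOR KEEPER RULING of 2026-08-25 (gem sweep H1: take the
off-gate kernel theorem `thmFstar` through the gate) — here its second namesake, `HodgeFermat/ThmFstarNFinal.lean:29`,
THEOREM F*(3N) at every admissible squarefree level (the first, `DecodingFinal.thmFstar` = THEOREM F* at the prime levels,
landed on 2026-08-25 as `HodgeFermatThmFstar.lean`, seat prover-1 gen-0); this file is one link of the import closure of
`ThmFstarNFinal.thmFstar` on top of that landed chain.  The source module's declarations are VERBATIM those of the cell record
`check/ThmFstarN_standalone.lean` (21 bodies, 438 871 B, sha256 ced731ec52c92191…, hub `lean check` rc 0, 222.2 s, `--axioms …ThmFstarN.thmFstarN` = [propext, Classical.choice, Quot.sound]; pub-hodgefermat `CERT.md` l.987, GATE HF-G33).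
Deviations from the source module, exhaustively: the `import` lines (tree modules `Summits.HodgeConjecture.FermatCycles.
HodgeFermat*` instead of `HodgeFermat.*`); this module docstring; this part imports parts 1 and 3 (§7 uses §§1–2 and §§3–6); the `set_option`/namespace/`open` preamble (source l.37–48) is repeated at the top because the module is split, followed by the two `open … renaming …` lines of part 1 (`odd_inv'`/`even_inv'` are used at source l.885, 909, 951, 980); one-line docstrings added (gate lint) to `card_ptsMu_le`, `muEntry_eq_zero_of_not_mem`, `card_suppMu_le`, `card_suppNu_le`, `nuDiff_eq_zero_of_not_mem`, `nuSymm_eq_zero_of_not_mem`. The module docstring is quoted in full in part 1.  Cell record of the whole module: `check/BadVanish_standalone.lean` (14 bodies, 327 549 B, sha256 `7a70017f76acb2eb…`, hub `lean check` rc 0, 22.8 s, `--axioms …BadVanish.thmFstar_of_ineq` = the trio).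
Every other line — in particular every declaration's statement and proof — is byte-identical to the source.
HONEST FRAMING: explicit algebraic cycles for specific Hodge classes on Fermat/Delsarte varieties; residual open instances
listed; no claim on general Hodge.  (This file is arithmetic of CM types / of `(ℤ/N)ˣ`; it claims nothing about cycles.)
-/

set_option autoImplicit false

namespace HodgeFermat.KRFree.BadVanish

open Finset HodgeFermat.KRFree.LemmaN HodgeFermat.KRFree.TwistedMoment HodgeFermat.KRFree.LemmaEMu
open HodgeFermat.KRFree.LemmaEGood
open HodgeFermat.KRFree.ChiThree (chi3 chi3_mul_self)
open HodgeFermat.KRFree.NuChar (chi3Mul chi3Mul_natCast)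
open HodgeFermat.KRFree.MuEven (muEntry muFun)
open HodgeFermat.KRFree.NuOdd (nuEntry nuFun nuEntry_eq_zero)
open HodgeFermat.KRFree.HypVDefs (tauV IneqV)
open DirichletCharacter (changeLevel annihilator subgroupOfPrimitiveMapToOne)
open Literature.NumberTheory.LFunctions.BernoulliOneOdd renaming odd_inv → odd_inv'
open HodgeFermat.KRFree.NuOdd renaming even_inv → even_inv'
/-! ### supports of `E⁻` and `D⁺` -/

section supports

variable {N : ℕ}

/-- the (at most two) points where `μ_a` lives, `t = 3⁻¹`: `a/3` if `3 ∣ a`, else `a` and `t·a` -/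
noncomputable def ptsMu (t : ZMod N) (a : ℕ) : Finset (ZMod N) :=
  if 3 ∣ a then {((a / 3 : ℕ) : ZMod N)} else {((a : ℕ) : ZMod N), t * ((a : ℕ) : ZMod N)}

/-- `#ptsMu t a ≤ 2` -/
lemma card_ptsMu_le (t : ZMod N) (a : ℕ) : (ptsMu t a).card ≤ 2 := by
  unfold ptsMu
  split_ifs
  · rw [Finset.card_singleton]; norm_num
  · exact Finset.card_insert_le _ _ |>.trans (by rw [Finset.card_singleton])

/-- `μ_a` vanishes off `ptsMu t a` (`t = 3⁻¹`) -/
lemma muEntry_eq_zero_of_not_mem {t : ZMod N} (ht : t * 3 = 1) {a : ℕ} {x : ZMod N}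
    (hx : x ∉ ptsMu t a) : muEntry a x = 0 := by
  unfold muEntry
  unfold ptsMu at hx
  by_cases h3 : 3 ∣ a
  · rw [if_pos h3]
    rw [if_pos h3, Finset.mem_singleton] at hx
    rw [if_neg (fun h => hx h.symm)]
  · rw [if_neg h3]
    rw [if_neg h3, Finset.mem_insert, Finset.mem_singleton, not_or] at hx
    have h1 : ((a : ℕ) : ZMod N) ≠ x := fun h => hx.1 h.symm
    have h2 : ((a : ℕ) : ZMod N) ≠ 3 * x := by
      intro h
      apply hx.2
      rw [h, ← mul_assoc, ht, one_mul]
    rw [if_neg h1, if_neg h2, sub_self]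

/-- support of `E⁻` -/
noncomputable def suppMu (t : ZMod N) (a b c a' b' c' : ℕ) : Finset (ZMod N) :=
  let S := ptsMu t a ∪ ptsMu t b ∪ ptsMu t c ∪ ptsMu t a' ∪ ptsMu t b' ∪ ptsMu t c'
  S ∪ S.image (fun x => -x)

/-- the support of `E⁻` has at most `24` points -/
lemma card_suppMu_le (t : ZMod N) (a b c a' b' c' : ℕ) : (suppMu t a b c a' b' c').card ≤ 24 := by
  unfold suppMu
  have hS : (ptsMu t a ∪ ptsMu t b ∪ ptsMu t c ∪ ptsMu t a' ∪ ptsMu t b' ∪ ptsMu t c').card ≤ 12 := by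
    have := card_ptsMu_le t a; have := card_ptsMu_le t b; have := card_ptsMu_le t c
    have := card_ptsMu_le t a'; have := card_ptsMu_le t b'; have := card_ptsMu_le t c'
    calc (ptsMu t a ∪ ptsMu t b ∪ ptsMu t c ∪ ptsMu t a' ∪ ptsMu t b' ∪ ptsMu t c').card
        ≤ (ptsMu t a ∪ ptsMu t b ∪ ptsMu t c ∪ ptsMu t a' ∪ ptsMu t b').card + (ptsMu t c').card :=
          Finset.card_union_le _ _
      _ ≤ (ptsMu t a ∪ ptsMu t b ∪ ptsMu t c ∪ ptsMu t a').card + (ptsMu t b').card + (ptsMu t c').card := by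
          gcongr; exact Finset.card_union_le _ _
      _ ≤ (ptsMu t a ∪ ptsMu t b ∪ ptsMu t c).card + (ptsMu t a').card + (ptsMu t b').card
            + (ptsMu t c').card := by
          gcongr; exact Finset.card_union_le _ _
      _ ≤ (ptsMu t a ∪ ptsMu t b).card + (ptsMu t c).card + (ptsMu t a').card + (ptsMu t b').card
            + (ptsMu t c').card := by
          gcongr; exact Finset.card_union_le _ _
      _ ≤ (ptsMu t a).card + (ptsMu t b).card + (ptsMu t c).card + (ptsMu t a').card + (ptsMu t b').card
            + (ptsMu t c').card := by
          gcongr; exact Finset.card_union_le _ _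
      _ ≤ 2 + 2 + 2 + 2 + 2 + 2 := by gcongr
      _ = 12 := by norm_num
  calc _ ≤ (ptsMu t a ∪ ptsMu t b ∪ ptsMu t c ∪ ptsMu t a' ∪ ptsMu t b' ∪ ptsMu t c').card
        + ((ptsMu t a ∪ ptsMu t b ∪ ptsMu t c ∪ ptsMu t a' ∪ ptsMu t b' ∪ ptsMu t c').image
            (fun x => -x)).card := Finset.card_union_le _ _
    _ ≤ 12 + 12 := Nat.add_le_add hS (Finset.card_image_le.trans hS)
    _ = 24 := by norm_num

/-- `E = μ_T − μ_T′` vanishes off `S` -/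
lemma muDiff_eq_zero_of_not_mem {t : ZMod N} (ht : t * 3 = 1) {a b c a' b' c' : ℕ} {x : ZMod N}
    (hx : x ∉ ptsMu t a ∪ ptsMu t b ∪ ptsMu t c ∪ ptsMu t a' ∪ ptsMu t b' ∪ ptsMu t c') :
    muFun (a, b, c) x - muFun (a', b', c') x = 0 := by
  simp only [Finset.mem_union, not_or] at hx
  obtain ⟨⟨⟨⟨⟨ha, hb⟩, hc⟩, ha'⟩, hb'⟩, hc'⟩ := hx
  simp only [muFun, muEntry_eq_zero_of_not_mem ht ha, muEntry_eq_zero_of_not_mem ht hb,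
    muEntry_eq_zero_of_not_mem ht hc, muEntry_eq_zero_of_not_mem ht ha', muEntry_eq_zero_of_not_mem ht hb',
    muEntry_eq_zero_of_not_mem ht hc', add_zero, sub_self]

/-- `E⁻` vanishes off `suppMu` -/
lemma muAnti_eq_zero_of_not_mem {t : ZMod N} (ht : t * 3 = 1) {a b c a' b' c' : ℕ} {x : ZMod N}
    (hx : x ∉ suppMu t a b c a' b' c') :
    ((muFun (a, b, c) x - muFun (a', b', c') x : ℤ) : ℂ)
      - ((muFun (a, b, c) (-x) - muFun (a', b', c') (-x) : ℤ) : ℂ) = 0 := by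
  unfold suppMu at hx
  simp only [Finset.mem_union, not_or] at hx
  obtain ⟨h1, h2⟩ := hx
  have h1' : x ∉ ptsMu t a ∪ ptsMu t b ∪ ptsMu t c ∪ ptsMu t a' ∪ ptsMu t b' ∪ ptsMu t c' := by
    simpa only [Finset.mem_union, not_or] using h1
  have h2' : -x ∉ ptsMu t a ∪ ptsMu t b ∪ ptsMu t c ∪ ptsMu t a' ∪ ptsMu t b' ∪ ptsMu t c' := by
    intro hmem
    apply h2
    rw [Finset.mem_image]
    exact ⟨-x, hmem, neg_neg x⟩
  rw [muDiff_eq_zero_of_not_mem ht h1', muDiff_eq_zero_of_not_mem ht h2']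
  simp

/-- support of `D⁺`: the six entries and their negatives -/
noncomputable def suppNu (a b c a' b' c' : ℕ) : Finset (ZMod N) :=
  let S : Finset (ZMod N) := {((a : ℕ) : ZMod N), ((b : ℕ) : ZMod N), ((c : ℕ) : ZMod N),
    ((a' : ℕ) : ZMod N), ((b' : ℕ) : ZMod N), ((c' : ℕ) : ZMod N)}
  S ∪ S.image (fun x => -x)

/-- the support of `D⁺` has at most `12` points -/
lemma card_suppNu_le (a b c a' b' c' : ℕ) : (suppNu (N := N) a b c a' b' c').card ≤ 12 := by
  unfold suppNu
  have hS : ({((a : ℕ) : ZMod N), ((b : ℕ) : ZMod N), ((c : ℕ) : ZMod N),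
      ((a' : ℕ) : ZMod N), ((b' : ℕ) : ZMod N), ((c' : ℕ) : ZMod N)} : Finset (ZMod N)).card ≤ 6 :=
    Finset.card_le_six
  calc _ ≤ ({((a : ℕ) : ZMod N), ((b : ℕ) : ZMod N), ((c : ℕ) : ZMod N),
      ((a' : ℕ) : ZMod N), ((b' : ℕ) : ZMod N), ((c' : ℕ) : ZMod N)} : Finset (ZMod N)).card
        + (({((a : ℕ) : ZMod N), ((b : ℕ) : ZMod N), ((c : ℕ) : ZMod N),
      ((a' : ℕ) : ZMod N), ((b' : ℕ) : ZMod N), ((c' : ℕ) : ZMod N)} : Finset (ZMod N)).image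
          (fun x => -x)).card := Finset.card_union_le _ _
    _ ≤ 6 + 6 := Nat.add_le_add hS (Finset.card_image_le.trans hS)
    _ = 12 := by norm_num

/-- `ν_T − ν_T′` vanishes off the six entries -/
lemma nuDiff_eq_zero_of_not_mem {a b c a' b' c' : ℕ} {x : ZMod N}
    (hx : x ∉ ({((a : ℕ) : ZMod N), ((b : ℕ) : ZMod N), ((c : ℕ) : ZMod N),
      ((a' : ℕ) : ZMod N), ((b' : ℕ) : ZMod N), ((c' : ℕ) : ZMod N)} : Finset (ZMod N))) :
    nuFun (a, b, c) x - nuFun (a', b', c') x = 0 := by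
  simp only [Finset.mem_insert, Finset.mem_singleton, not_or] at hx
  obtain ⟨ha, hb, hc, ha', hb', hc'⟩ := hx
  simp only [nuFun, nuEntry_eq_zero (Ne.symm ha), nuEntry_eq_zero (Ne.symm hb), nuEntry_eq_zero (Ne.symm hc),
    nuEntry_eq_zero (Ne.symm ha'), nuEntry_eq_zero (Ne.symm hb'), nuEntry_eq_zero (Ne.symm hc'), add_zero,
    sub_self]

/-- the symmetrised `ν_T − ν_T′` vanishes off `suppNu` -/
lemma nuSymm_eq_zero_of_not_mem {a b c a' b' c' : ℕ} {x : ZMod N}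
    (hx : x ∉ suppNu (N := N) a b c a' b' c') :
    ((nuFun (a, b, c) x - nuFun (a', b', c') x : ℤ) : ℂ)
      + ((nuFun (a, b, c) (-x) - nuFun (a', b', c') (-x) : ℤ) : ℂ) = 0 := by
  unfold suppNu at hx
  rw [Finset.mem_union, not_or] at hx
  obtain ⟨h1, h2⟩ := hx
  have h2' : -x ∉ ({((a : ℕ) : ZMod N), ((b : ℕ) : ZMod N), ((c : ℕ) : ZMod N),
      ((a' : ℕ) : ZMod N), ((b' : ℕ) : ZMod N), ((c' : ℕ) : ZMod N)} : Finset (ZMod N)) := by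
    intro hmem
    apply h2
    rw [Finset.mem_image]
    exact ⟨-x, hmem, neg_neg x⟩
  rw [nuDiff_eq_zero_of_not_mem h1, nuDiff_eq_zero_of_not_mem h2']
  simp

end supports

/-! ## 7. The Bad coefficients vanish under `IneqV N`; THEOREM F\*(3N) -/

section main

variable {N : ℕ} [NeZero N]

/-- **`μ_T − μ_T′` is EVEN** under `IneqV N` (squarefree `N > 1`, `3 ∤ N`; from H0). -/
theorem mu_even_of_ineq (h0 : H0) (h1N : 1 < N) (h3N : ¬ 3 ∣ N) (hsq : Squarefree N) (hV : IneqV N)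
    {a b c a' b' c' : ℕ} (hs : 3 * N ∣ a + b + c) (hs' : 3 * N ∣ a' + b' + c')
    (ha : Nat.Coprime a N) (hb : Nat.Coprime b N) (hc : Nat.Coprime c N)
    (ha' : Nat.Coprime a' N) (hb' : Nat.Coprime b' N) (hc' : Nat.Coprime c' N)
    (hT : SameType (3 * N) (a, b, c) (a', b', c')) (x : ZMod N) :
    muFun (a, b, c) (-x) - muFun (a', b', c') (-x) = muFun (a, b, c) x - muFun (a', b', c') x := by
  classical
  obtain ⟨t3, ht3⟩ := isUnit_three h3N
  set t : ZMod N := ((t3⁻¹ : (ZMod N)ˣ) : ZMod N) with htdef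
  have ht : t * 3 = 1 := by rw [htdef, ← ht3, Units.inv_mul]
  set E : ZMod N → ℂ := fun y => ((muFun (a, b, c) y - muFun (a', b', c') y : ℤ) : ℂ) with hE
  set f : ZMod N → ℂ := fun y => E y - E (-y) with hf
  have hunitE : ∀ y, ¬ IsUnit y → E y = 0 := by
    intro y hy
    simp only [hE, muFun_nonunit ha hb hc hy, muFun_nonunit ha' hb' hc' hy, sub_self, Int.cast_zero]
  have hunit : ∀ y, ¬ IsUnit y → f y = 0 := by
    intro y hy
    have hy' : ¬ IsUnit (-y) := fun h => hy (by simpa using h.neg)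
    simp only [hf, hunitE y hy, hunitE (-y) hy', sub_self]
  have hsupp : (Finset.univ.filter (fun y => f y ≠ 0)).card ≤ 24 := by
    refine le_trans (Finset.card_le_card ?_) (card_suppMu_le t a b c a' b' c')
    intro y hy
    rw [Finset.mem_filter] at hy
    by_contra hmem
    exact hy.2 (muAnti_eq_zero_of_not_mem ht hmem)
  have hB : ∀ χ, χ ∉ badMu N → hat f χ = 0 := by
    intro χ hχ
    rw [badMu, Finset.mem_filter, not_and_or] at hχ
    rcases hχ with h | h
    · exact absurd (Finset.mem_univ χ) h
    rw [not_and_or, not_not] at h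
    rcases χ.even_or_odd with he | ho
    · exact hat_sub_neg_of_even E χ he
    · rcases h with h | hgood
      · exact absurd ho h
      · rw [hf, hat_sub_neg_of_odd E χ ho]
        have key := hat_mu_diff_eq_zero_of_good h0 h1N h3N χ⁻¹ (odd_inv' ho) hgood hs hs' ha hb hc
          ha' hb' hc' hT
        rw [inv_inv] at key
        unfold hat
        rw [hE]
        simp only
        rw [key, mul_zero]
  have hbad : 24 * (badMu N).card < N.totient := by
    have := two_mul_card_badMu_le (N := N) hsq
    unfold IneqV at hV
    omega
  have hzero := coreB f (badMu N) 24 hunit hsupp hB hbad x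
  simp only [hf, hE, sub_eq_zero] at hzero
  exact_mod_cast hzero.symm

/-- the Bad μ-coefficients vanish under `IneqV N` -/
theorem badVanishMu_of_ineq (h0 : H0) (h1N : 1 < N) (h3N : ¬ 3 ∣ N) (hsq : Squarefree N) (hV : IneqV N)
    {a b c a' b' c' : ℕ} (hs : 3 * N ∣ a + b + c) (hs' : 3 * N ∣ a' + b' + c')
    (ha : Nat.Coprime a N) (hb : Nat.Coprime b N) (hc : Nat.Coprime c N)
    (ha' : Nat.Coprime a' N) (hb' : Nat.Coprime b' N) (hc' : Nat.Coprime c' N)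
    (hT : SameType (3 * N) (a, b, c) (a', b', c')) : BadVanishMu N (a, b, c) (a', b', c') := by
  intro ψ hψ _
  exact sum_mul_eq_zero_of_even_odd (fun y => ((muFun (a, b, c) y - muFun (a', b', c') y : ℤ) : ℂ))
    (fun y => by exact_mod_cast mu_even_of_ineq h0 h1N h3N hsq hV hs hs' ha hb hc ha' hb' hc' hT y)
    ψ⁻¹ (odd_inv' hψ)

/-- **`ν_T − ν_T′` is ODD** under `IneqV N` (squarefree `N > 1`, `3 ∤ N`; from H0). -/
theorem nu_odd_of_ineq (h0 : H0) (h1N : 1 < N) (h3N : ¬ 3 ∣ N) (hsq : Squarefree N) (hV : IneqV N)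
    {a b c a' b' c' : ℕ} (hs : 3 * N ∣ a + b + c) (hs' : 3 * N ∣ a' + b' + c')
    (ha : Nat.Coprime a N) (hb : Nat.Coprime b N) (hc : Nat.Coprime c N)
    (ha' : Nat.Coprime a' N) (hb' : Nat.Coprime b' N) (hc' : Nat.Coprime c' N)
    (hT : SameType (3 * N) (a, b, c) (a', b', c')) (x : ZMod N) :
    nuFun (a, b, c) (-x) - nuFun (a', b', c') (-x) = - (nuFun (a, b, c) x - nuFun (a', b', c') x) := by
  classical
  set D : ZMod N → ℂ := fun y => ((nuFun (a, b, c) y - nuFun (a', b', c') y : ℤ) : ℂ) with hD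
  set f : ZMod N → ℂ := fun y => D y + D (-y) with hf
  have hne : ∀ {y : ℕ}, Nat.Coprime y N → ∀ {z : ZMod N}, ¬ IsUnit z → ((y : ℕ) : ZMod N) ≠ z := by
    intro y hy z hz h
    exact hz (h ▸ (ZMod.isUnit_iff_coprime y N).mpr hy)
  have hunitD : ∀ y, ¬ IsUnit y → D y = 0 := by
    intro y hy
    simp only [hD, nuFun, nuEntry_eq_zero (hne ha hy), nuEntry_eq_zero (hne hb hy), nuEntry_eq_zero (hne hc hy),
      nuEntry_eq_zero (hne ha' hy), nuEntry_eq_zero (hne hb' hy), nuEntry_eq_zero (hne hc' hy), add_zero,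
      sub_self, Int.cast_zero]
  have hunit : ∀ y, ¬ IsUnit y → f y = 0 := by
    intro y hy
    have hy' : ¬ IsUnit (-y) := fun h => hy (by simpa using h.neg)
    simp only [hf, hunitD y hy, hunitD (-y) hy', add_zero]
  have hsupp : (Finset.univ.filter (fun y => f y ≠ 0)).card ≤ 12 := by
    refine le_trans (Finset.card_le_card ?_) (card_suppNu_le (N := N) a b c a' b' c')
    intro y hy
    rw [Finset.mem_filter] at hy
    by_contra hmem
    exact hy.2 (nuSymm_eq_zero_of_not_mem hmem)
  have hB : ∀ χ, χ ∉ badNu N → hat f χ = 0 := by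
    intro χ hχ
    rw [badNu, Finset.mem_filter, not_and_or] at hχ
    rcases hχ with h | h
    · exact absurd (Finset.mem_univ χ) h
    rw [not_or, not_and_or, not_not] at h
    obtain ⟨hχ1, h⟩ := h
    rcases χ.even_or_odd with he | ho
    · rcases h with h | hgood
      · exact absurd he h
      · rw [hf, hat_add_neg_of_even D χ he]
        have hne1 : χ⁻¹ ≠ 1 := fun h1 => hχ1 (inv_eq_one.mp h1)
        have key := hat_nu_diff_eq_zero_of_good h0 h1N h3N χ⁻¹ (even_inv' he) hgood hs hs' ha hb hc
          ha' hb' hc' hT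
        rw [inv_inv] at key
        unfold hat
        rw [hD]
        simp only
        rw [key, mul_zero]
    · exact hat_add_neg_of_odd D χ ho
  have hbad : 12 * (badNu N).card < N.totient := by
    have := card_badNu_le (N := N) hsq h3N
    unfold IneqV at hV
    omega
  have hzero := coreB f (badNu N) 12 hunit hsupp hB hbad x
  simp only [hf, hD] at hzero
  have : ((nuFun (a, b, c) (-x) - nuFun (a', b', c') (-x) : ℤ) : ℂ)
      = - ((nuFun (a, b, c) x - nuFun (a', b', c') x : ℤ) : ℂ) := by linear_combination hzero
  exact_mod_cast this

/-- the Bad ν-coefficients vanish under `IneqV N` -/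
theorem badVanishNu_of_ineq (h0 : H0) (h1N : 1 < N) (h3N : ¬ 3 ∣ N) (hsq : Squarefree N) (hV : IneqV N)
    {a b c a' b' c' : ℕ} (hs : 3 * N ∣ a + b + c) (hs' : 3 * N ∣ a' + b' + c')
    (ha : Nat.Coprime a N) (hb : Nat.Coprime b N) (hc : Nat.Coprime c N)
    (ha' : Nat.Coprime a' N) (hb' : Nat.Coprime b' N) (hc' : Nat.Coprime c' N)
    (hT : SameType (3 * N) (a, b, c) (a', b', c')) : BadVanishNu N (a, b, c) (a', b', c') := by
  intro ψ hψ _ _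
  exact sum_mul_eq_zero_of_odd_even (fun y => ((nuFun (a, b, c) y - nuFun (a', b', c') y : ℤ) : ℂ))
    (fun y => by
      have := nu_odd_of_ineq h0 h1N h3N hsq hV hs hs' ha hb hc ha' hb' hc' hT y
      rw [this]; push_cast; ring)
    ψ⁻¹ (even_inv' hψ)

/-- **THEOREM F\*(3N) under HYPOTHESIS V at `N` (from H0).**  `N ≥ 11` squarefree, `3 ∤ N`, `N ≠ 13`, `IneqV N`:
two zero-sum triples mod `3N` with entries prime to `N` and DISJOINT mod `3N` never have the same CM type. -/
theorem thmFstar_of_ineq (h0 : H0) (hn11 : 11 ≤ N) (h3N : ¬ 3 ∣ N) (hn13 : N ≠ 13) (hsq : Squarefree N)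
    (hV : IneqV N) {a b c a' b' c' : ℕ} (hs : 3 * N ∣ a + b + c) (hs' : 3 * N ∣ a' + b' + c')
    (ha : Nat.Coprime a N) (hb : Nat.Coprime b N) (hc : Nat.Coprime c N)
    (ha' : Nat.Coprime a' N) (hb' : Nat.Coprime b' N) (hc' : Nat.Coprime c' N)
    (hD : ∀ u v, (u = a ∨ u = b ∨ u = c) → (v = a' ∨ v = b' ∨ v = c') → ¬ u ≡ v [MOD 3 * N])
    (hT : SameType (3 * N) (a, b, c) (a', b', c')) : False :=
  thmFstar_of_bad h0 hn11 h3N hn13 hs hs' ha hb hc ha' hb' hc' hD hT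
    (badVanishMu_of_ineq h0 (by omega) h3N hsq hV hs hs' ha hb hc ha' hb' hc' hT)
    (badVanishNu_of_ineq h0 (by omega) h3N hsq hV hs hs' ha hb hc ha' hb' hc' hT)

end main

end HodgeFermat.KRFree.BadVanish
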